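import Literature.NumberTheory.ConnesConsani2021.ProlateEigenvalueMomentDecay
import Mathlib.Analysis.Complex.Exponential
import Mathlib.Analysis.Real.Pi.Bounds
import HarnessLib

/-!
# Osipov 2013, Theorem 33 at band-limit `c = 2π` — PROVED (discharge of `Osipov2013_thm_33`)

LINE 1 — FRAMING.  RH-FREE corpus literature (classical analysis of the prolate spheroidal eigenvalues
`λ_n(c)` at band-limit `c = 2π`); bears_on: LADDER-RH W-C/W-P only as §4 FACT-LIST bookkeeping of the
cell rh-crit (the boundary fact `Osipov2013_thm_33` of `ProlateEigenvalueDecay.lean` is OFF the K0/K2 cone,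
which closed without it).  WHAT THIS IS NOT: any claim about `ζ` or RH, and NOT a formalisation of
Osipov's own proof (his Thms 9, 22, 23 / the Prüfer–WKB analysis); nothing here bears on the truth of RH.

## What is proved, and how

`Osipov2013_thm_33_holds : Osipov2013_thm_33` — the named fact of
`Literature/NumberTheory/LFunctions/ProlateEigenvalueDecay.lean` (A. Osipov, *Certain upper bounds on
the eigenvalues associated with prolate spheroidal wave functions*, Appl. Comput. Harmon. Anal. 35 (2013),
Thm. 33 [cite: Osipov2013, Thm. 33 (arXiv:1206.4541 chunk p0018:L158–L175)], typed at `c = 2π` over the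
tree's `IsProlateFunction 1 n f`): for an even index `n > 4 + √42` (so `n = 2m`, `m ≥ 6`),
`|μ| < 1195·2π·x^{3/4}(x−1)^{1/4}(x−½)³·exp(−(π/4)(√x − 1/√x)·2π)`, `x = χ/(2π)²`.

ROAD (a comparison road available ONLY at the typed band-limit `c = 2π`, where the tree already holds
elementary explicit bounds for CC's `λ(m) = λ_{2m}^{2π}`; it is NOT the printed proof, which is the
general-`c` WKB analysis of [Osipov2013, §4] resting on [Osipov2012Inequalities, Thms 6–9]):

1. Dictionary (`§4`): `f = prolateFun m` (uniqueness, `eq_prolateFun_of_isProlateFunction`), and the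
   Fourier eigen-relation at `ω = 0` gives `μ = (∫f)/f(0) = prolateEigen m`; Wang's window
   `2m(2m+1) < χ < 2m(2m+1) + 4π²` (`Wang2010_lemma_2_2_holds`, PROVED in the tree by Sturm comparison).
2. A lower envelope of Osipov's right-hand side on that window (`osipovBound_lower`, §2): with
   `x₀ = 2m(2m+1)/(2π)²`, `x^{3/4}(x−1)^{1/4} ≥ x − 1 ≥ x₀ − 1`, `(x−½)³ ≥ (x₀−½)³`, and
   `√x ≤ s := (2m+π)/(2π)` (as `χ < 4m²+2m+4π² ≤ (2m+π)²` for `m ≥ 3`) with `t ↦ t − 1/t` increasing, so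
   `exp(−(π²/2)(√x − 1/√x)) ≥ exp(−(π²/2)(s − 1/s)) = e^{−π²/4}·(e^{−π/2})^m·e^{π³/(2m+π)}` and
   `e^y ≥ 1 + y`:  `RHS ≥ L(m) := 1195·2π·(x₀−1)(x₀−½)³·e^{−π²/4}·(e^{−π/2})^m·(1 + π³/(2m+π))`.
3. Three regimes, each dominated by a LANDED tree bound on `|λ(m)|` (§3; rational envelopes with
   `π ∈ (3.14159, 3.1416)`, `e^{−π/2} ≥ 0.2078`, `e^{−π²/4} ≥ 0.0847` from `Real.exp_bound'`):
   (A) `6 ≤ m ≤ 10`: `L(m) > 1 > |λ(m)|` (`abs_prolateEigen_lt_one`, ProlateProjectionsProofs);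
   (B) `11 ≤ m ≤ 21`: the moment-sum bound `abs_prolateEigen_le_momentSum` of
       `ProlateEigenvalueMomentDecay.lean` (cc-t6 g3, p442467), numerically `< L(m)` (margins `≥ 13`);
   (C) `m ≥ 22`: `|λ(m)| ≤ 4(4π²)^m/(m!)²` (`abs_prolateEigen_le_explicit`, loc. cit.), whose ratio
       `4π²/(m+1)² ≤ 4π²/23² < e^{−π/2}` is dominated by the geometric ratio of `L`, plus the base case
       `m = 22` (margin `≈ 9`).
Float sanity (seat folder `work/osip.py`, `work/ratcheck.py`): on every Wang window the true minimum of
Osipov's right-hand side exceeds `momentSum(m)` for all `m ≥ 6` and the factorial bound for `m ≥ 20`.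

THEOREMS ONLY (no `def`, no new named fact; net debt −1).  Nothing here bears on the truth of RH.
-/

noncomputable section

open Real Set MeasureTheory Filter Topology Finset intervalIntegral Complex

namespace Literature.NumberTheory.LFunctions

open Literature.NumberTheory.ConnesConsani2021

/-! ## §1 Numerical constants: `e^{−π/2} ≥ 0.2078`, `e^{−π²/4} ≥ 0.0847`, `4π² ≤ 39.4787`, `π³ ≥ 31.006` -/

/-- `exp(π/4) ≤ exp(0.7854) ≤` its degree-7 Taylor polynomial plus the standard remainder
(Mathlib `Real.exp_bound'`), whence `e^{−π/2} = (e^{π/4})^{−2} ≥ 0.2078` (true value `0.207879…`).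
[folklore] -/
private theorem exp_neg_pi_div_two_ge : (2078 / 10000 : ℝ) ≤ Real.exp (-(π / 2)) := by
  have hy : π / 4 ≤ (7854 / 10000 : ℝ) := by linarith [Real.pi_lt_d4]
  have hU := Real.exp_bound' (x := (7854 / 10000 : ℝ)) (by norm_num) (by norm_num) (n := 8)
    (by norm_num)
  have hexp : Real.exp (π / 4) ≤ ∑ m ∈ range 8, (7854 / 10000 : ℝ) ^ m / m.factorial +
      (7854 / 10000 : ℝ) ^ 8 * (8 + 1) / (Nat.factorial 8 * 8) :=
    (Real.exp_le_exp.2 hy).trans (by exact_mod_cast hU)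
  have hpos : 0 < Real.exp (π / 4) := Real.exp_pos _
  have hrew : Real.exp (-(π / 2)) = (Real.exp (π / 4))⁻¹ ^ 2 := by
    rw [← Real.exp_neg, ← Real.exp_nat_mul]
    congr 1
    ring
  rw [hrew]
  have hU' : ∑ m ∈ range 8, (7854 / 10000 : ℝ) ^ m / m.factorial +
      (7854 / 10000 : ℝ) ^ 8 * (8 + 1) / (Nat.factorial 8 * 8) ≤ 219331 / 100000 := by
    norm_num [Finset.sum_range_succ, Nat.factorial]
  have h1 : (219331 / 100000 : ℝ)⁻¹ ≤ (Real.exp (π / 4))⁻¹ :=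
    inv_anti₀ hpos (hexp.trans hU')
  calc (2078 / 10000 : ℝ) ≤ (219331 / 100000 : ℝ)⁻¹ ^ 2 := by norm_num
    _ ≤ (Real.exp (π / 4))⁻¹ ^ 2 := pow_le_pow_left₀ (by norm_num) h1 2

/-- `e^{−π²/4} = (e^{π²/16})^{−4} ≥ 0.0847` (true value `0.084805…`), from `π²/16 ≤ 0.61686` and
`Real.exp_bound'` (Taylor bound for `exp`). [folklore] -/
private theorem exp_neg_pi_sq_div_four_ge : (847 / 10000 : ℝ) ≤ Real.exp (-(π ^ 2 / 4)) := by
  have hπ := Real.pi_lt_d4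
  have hπ0 := Real.pi_pos
  have hy : π ^ 2 / 16 ≤ (61686 / 100000 : ℝ) := by nlinarith
  have hU := Real.exp_bound' (x := (61686 / 100000 : ℝ)) (by norm_num) (by norm_num) (n := 8)
    (by norm_num)
  have hexp : Real.exp (π ^ 2 / 16) ≤ ∑ m ∈ range 8, (61686 / 100000 : ℝ) ^ m / m.factorial +
      (61686 / 100000 : ℝ) ^ 8 * (8 + 1) / (Nat.factorial 8 * 8) :=
    (Real.exp_le_exp.2 hy).trans (by exact_mod_cast hU)
  have hpos : 0 < Real.exp (π ^ 2 / 16) := Real.exp_pos _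
  have hrew : Real.exp (-(π ^ 2 / 4)) = (Real.exp (π ^ 2 / 16))⁻¹ ^ 4 := by
    rw [← Real.exp_neg, ← Real.exp_nat_mul]
    congr 1
    ring
  rw [hrew]
  have hU' : ∑ m ∈ range 8, (61686 / 100000 : ℝ) ^ m / m.factorial +
      (61686 / 100000 : ℝ) ^ 8 * (8 + 1) / (Nat.factorial 8 * 8) ≤ 185312 / 100000 := by
    norm_num [Finset.sum_range_succ, Nat.factorial]
  have h1 : (185312 / 100000 : ℝ)⁻¹ ≤ (Real.exp (π ^ 2 / 16))⁻¹ :=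
    inv_anti₀ hpos (hexp.trans hU')
  calc (847 / 10000 : ℝ) ≤ (185312 / 100000 : ℝ)⁻¹ ^ 4 := by norm_num
    _ ≤ (Real.exp (π ^ 2 / 16))⁻¹ ^ 4 := pow_le_pow_left₀ (by norm_num) h1 4

/-- `(2π)² = 4π² ≤ 39.4787` (Mathlib `Real.pi_lt_d4`: `π < 3.1416`). [folklore] -/
private theorem two_pi_sq_le : (2 * π) ^ 2 ≤ (394787 / 10000 : ℝ) := by
  nlinarith [Real.pi_lt_d4, Real.pi_pos]

/-- `π³ ≥ 31.006` (Mathlib `Real.pi_gt_d6`: `π > 3.141592`). [folklore] -/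
private theorem pi_cube_ge : (31006 / 1000 : ℝ) ≤ π ^ 3 := by
  nlinarith [Real.pi_gt_d6, Real.pi_pos, sq_nonneg π]


/-! ## §2 The lower envelope of Osipov's right-hand side on Wang's window -/

/-- **Lower envelope.**  For CC's index `m ≥ 6` and `χ` in Wang's window `2m(2m+1) < χ < 2m(2m+1) + 4π²`
(so `x = χ/(2π)² ∈ (x₀, x₀ + 1)`, `x₀ = 2m(2m+1)/(2π)² > 1`), Osipov's right-hand side at `c = 2π` is at
least `L(m) = 1195·2π·(x₀−1)(x₀−½)³·e^{−π²/4}·(e^{−π/2})^m·(1 + π³/(2m+π))`: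
`x^{3/4}(x−1)^{1/4} ≥ x−1 ≥ x₀−1`, `(x−½)³ ≥ (x₀−½)³`, and, with `s = (2m+π)/(2π) ≥ √x`
(`χ < 4m² + 2m + 4π² ≤ (2m+π)²`) and `t ↦ t − 1/t` increasing,
`−(π/4)(√x − 1/√x)(2π) ≥ −(π²/2)(s − 1/s) = −π²/4 − πm/2 + π³/(2m+π)`, `e^y ≥ 1 + y`.
[cite: Osipov2013, Thm. 33 (arXiv:1206.4541 chunk p0018:L158–L175); WangLL2010, Lemma 2.2 eq. (2.6)] -/
theorem osipovBound_lower {m : ℕ} (hm : 6 ≤ m) {χ : ℝ}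
    (hlo : 2 * (m : ℝ) * (2 * m + 1) < χ) (hhi : χ < 2 * (m : ℝ) * (2 * m + 1) + (2 * π) ^ 2) :
    1195 * (2 * π) * (2 * (m : ℝ) * (2 * m + 1) / (2 * π) ^ 2 - 1)
        * (2 * (m : ℝ) * (2 * m + 1) / (2 * π) ^ 2 - 1 / 2) ^ 3
        * Real.exp (-(π ^ 2 / 4)) * Real.exp (-(π / 2)) ^ m * (1 + π ^ 3 / (2 * m + π))
      ≤ 1195 * (2 * π) * (χ / (2 * π) ^ 2) ^ (3 / 4 : ℝ) * (χ / (2 * π) ^ 2 - 1) ^ (1 / 4 : ℝ) *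
        (χ / (2 * π) ^ 2 - 1 / 2) ^ 3 *
        Real.exp (-(π / 4) * (Real.sqrt (χ / (2 * π) ^ 2) - 1 / Real.sqrt (χ / (2 * π) ^ 2))
          * (2 * π)) := by
  have hm' : (6 : ℝ) ≤ m := by exact_mod_cast hm
  have hπ := Real.pi_pos
  have hπ3 := Real.pi_gt_three
  have hπ4 := Real.pi_lt_d4
  have hc2 : (0 : ℝ) < (2 * π) ^ 2 := by positivity
  set x : ℝ := χ / (2 * π) ^ 2 with hx
  set x₀ : ℝ := 2 * (m : ℝ) * (2 * m + 1) / (2 * π) ^ 2 with hx₀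
  have hx₀x : x₀ < x := div_lt_div_of_pos_right hlo hc2
  have hx₀1 : 1 < x₀ := by
    rw [hx₀, lt_div_iff₀ hc2]
    nlinarith
  have hx1 : 1 < x := hx₀1.trans hx₀x
  have hx0 : 0 < x := by linarith
  -- (a) the algebraic prefactor
  have hA : x₀ - 1 ≤ x ^ (3 / 4 : ℝ) * (x - 1) ^ (1 / 4 : ℝ) := by
    have h34 : (x - 1) ^ (3 / 4 : ℝ) ≤ x ^ (3 / 4 : ℝ) :=
      Real.rpow_le_rpow (by linarith) (by linarith) (by norm_num)
    have hsplit : (x - 1) ^ (3 / 4 : ℝ) * (x - 1) ^ (1 / 4 : ℝ) = x - 1 := by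
      rw [← Real.rpow_add (by linarith : (0 : ℝ) < x - 1)]
      norm_num
    have h14 : 0 ≤ (x - 1) ^ (1 / 4 : ℝ) := Real.rpow_nonneg (by linarith) _
    calc x₀ - 1 ≤ x - 1 := by linarith
      _ = (x - 1) ^ (3 / 4 : ℝ) * (x - 1) ^ (1 / 4 : ℝ) := hsplit.symm
      _ ≤ x ^ (3 / 4 : ℝ) * (x - 1) ^ (1 / 4 : ℝ) := by gcongr
  have hB : (x₀ - 1 / 2) ^ 3 ≤ (x - 1 / 2) ^ 3 :=
    pow_le_pow_left₀ (by linarith) (by linarith) 3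
  -- (b) the exponent
  set s : ℝ := (2 * m + π) / (2 * π) with hs
  have hs0 : 0 < s := by positivity
  have hχs : χ ≤ (2 * m + π) ^ 2 := by nlinarith
  have hxs : x ≤ s ^ 2 := by
    rw [hx, hs, div_pow]
    exact div_le_div_of_nonneg_right hχs hc2.le
  have hsqrt : Real.sqrt x ≤ s := by
    rw [show s = Real.sqrt (s ^ 2) from (Real.sqrt_sq hs0.le).symm]
    exact Real.sqrt_le_sqrt hxs
  have hsx0 : 0 < Real.sqrt x := Real.sqrt_pos.2 hx0
  have hinv : 1 / s ≤ 1 / Real.sqrt x := one_div_le_one_div_of_le hsx0 hsqrt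
  have hdiff : Real.sqrt x - 1 / Real.sqrt x ≤ s - 1 / s := by linarith
  have harg : -(π / 4) * (s - 1 / s) * (2 * π) ≤
      -(π / 4) * (Real.sqrt x - 1 / Real.sqrt x) * (2 * π) := by
    have h := mul_le_mul_of_nonneg_left hdiff (by positivity : (0 : ℝ) ≤ π / 4 * (2 * π))
    linarith
  have hmπ : (2 * (m : ℝ) + π) ≠ 0 := by positivity
  have key : -(π / 4) * (s - 1 / s) * (2 * π) =
      -(π ^ 2 / 4) + (m : ℝ) * (-(π / 2)) + π ^ 3 / (2 * m + π) := by
    rw [hs]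
    field_simp
    ring
  have hE : Real.exp (-(π ^ 2 / 4)) * Real.exp (-(π / 2)) ^ m * (1 + π ^ 3 / (2 * m + π)) ≤
      Real.exp (-(π / 4) * (Real.sqrt x - 1 / Real.sqrt x) * (2 * π)) := by
    have h1 : 1 + π ^ 3 / (2 * m + π) ≤ Real.exp (π ^ 3 / (2 * m + π)) := by
      linarith [Real.add_one_le_exp (π ^ 3 / (2 * m + π))]
    calc Real.exp (-(π ^ 2 / 4)) * Real.exp (-(π / 2)) ^ m * (1 + π ^ 3 / (2 * m + π))
        ≤ Real.exp (-(π ^ 2 / 4)) * Real.exp (-(π / 2)) ^ m * Real.exp (π ^ 3 / (2 * m + π)) := by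
          gcongr
      _ = Real.exp (-(π / 4) * (s - 1 / s) * (2 * π)) := by
          rw [key, Real.exp_add, Real.exp_add, Real.exp_nat_mul]
      _ ≤ Real.exp (-(π / 4) * (Real.sqrt x - 1 / Real.sqrt x) * (2 * π)) :=
          Real.exp_le_exp.2 harg
  -- assemble (factor by factor, all factors non-negative)
  have hE0 : 0 ≤ Real.exp (-(π ^ 2 / 4)) * Real.exp (-(π / 2)) ^ m * (1 + π ^ 3 / (2 * m + π)) := by
    positivity
  have hK : (0 : ℝ) ≤ 1195 * (2 * π) := by positivity
  have hP : 0 ≤ x ^ (3 / 4 : ℝ) * (x - 1) ^ (1 / 4 : ℝ) :=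
    mul_nonneg (Real.rpow_nonneg hx0.le _) (Real.rpow_nonneg (by linarith) _)
  have hB0 : 0 ≤ (x₀ - 1 / 2) ^ 3 := pow_nonneg (by linarith) 3
  have hX3 : 0 ≤ (x - 1 / 2) ^ 3 := pow_nonneg (by linarith) 3
  have step1 : 1195 * (2 * π) * (x₀ - 1) ≤ 1195 * (2 * π) * (x ^ (3 / 4 : ℝ) * (x - 1) ^ (1 / 4 : ℝ)) :=
    mul_le_mul_of_nonneg_left hA hK
  have step2 : 1195 * (2 * π) * (x₀ - 1) * (x₀ - 1 / 2) ^ 3 ≤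
      1195 * (2 * π) * (x ^ (3 / 4 : ℝ) * (x - 1) ^ (1 / 4 : ℝ)) * (x - 1 / 2) ^ 3 :=
    mul_le_mul step1 hB hB0 (mul_nonneg hK hP)
  have step3 := mul_le_mul step2 hE hE0 (mul_nonneg (mul_nonneg hK hP) hX3)
  calc 1195 * (2 * π) * (x₀ - 1) * (x₀ - 1 / 2) ^ 3 * Real.exp (-(π ^ 2 / 4)) *
        Real.exp (-(π / 2)) ^ m * (1 + π ^ 3 / (2 * m + π))
      = 1195 * (2 * π) * (x₀ - 1) * (x₀ - 1 / 2) ^ 3 *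
        (Real.exp (-(π ^ 2 / 4)) * Real.exp (-(π / 2)) ^ m * (1 + π ^ 3 / (2 * m + π))) := by ring
    _ ≤ 1195 * (2 * π) * (x ^ (3 / 4 : ℝ) * (x - 1) ^ (1 / 4 : ℝ)) * (x - 1 / 2) ^ 3 *
        Real.exp (-(π / 4) * (Real.sqrt x - 1 / Real.sqrt x) * (2 * π)) := step3
    _ = _ := by ring

/-- **Rational lower envelope (without the last factor).**  With `π ∈ (3.14159, 3.1416)`,
`(2π)² ≤ 39.4787`, `e^{−π²/4} ≥ 0.0847`, `e^{−π/2} ≥ 0.2078`: for `m ≥ 6`,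
`1195·2π·(x₀−1)(x₀−½)³·e^{−π²/4}·(e^{−π/2})^m` is at least the rational quantity
`1195·6.28318·(x₁−1)(x₁−½)³·0.0847·0.2078^m`, `x₁ = 2m(2m+1)/39.4787 ≤ x₀`.
[cite: Osipov2013, Thm. 33; WangLL2010, Lemma 2.2] -/
private theorem osipovLowerRat'_le {m : ℕ} (hm : 6 ≤ m) :
    1195 * (2 * (314159 / 100000 : ℝ)) * (2 * (m : ℝ) * (2 * m + 1) / (394787 / 10000) - 1)
        * (2 * (m : ℝ) * (2 * m + 1) / (394787 / 10000) - 1 / 2) ^ 3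
        * (847 / 10000) * (2078 / 10000) ^ m
      ≤ 1195 * (2 * π) * (2 * (m : ℝ) * (2 * m + 1) / (2 * π) ^ 2 - 1)
        * (2 * (m : ℝ) * (2 * m + 1) / (2 * π) ^ 2 - 1 / 2) ^ 3
        * Real.exp (-(π ^ 2 / 4)) * Real.exp (-(π / 2)) ^ m := by
  have hm' : (6 : ℝ) ≤ m := by exact_mod_cast hm
  have hπlo : (314159 / 100000 : ℝ) ≤ π := by linarith [Real.pi_gt_d6]
  have hc2 : (0 : ℝ) < (2 * π) ^ 2 := by positivity
  have hN : (0 : ℝ) ≤ 2 * (m : ℝ) * (2 * m + 1) := by positivity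
  have hfrac : 2 * (m : ℝ) * (2 * m + 1) / (394787 / 10000) ≤
      2 * (m : ℝ) * (2 * m + 1) / (2 * π) ^ 2 :=
    div_le_div_of_nonneg_left hN hc2 two_pi_sq_le
  have h1 : (0 : ℝ) ≤ 2 * (m : ℝ) * (2 * m + 1) / (394787 / 10000) - 1 := by
    rw [sub_nonneg, le_div_iff₀ (by norm_num)]
    nlinarith
  have h2 : (0 : ℝ) ≤ 2 * (m : ℝ) * (2 * m + 1) / (394787 / 10000) - 1 / 2 := by linarith
  have hr1 : (0 : ℝ) ≤ 2 * (m : ℝ) * (2 * m + 1) / (2 * π) ^ 2 - 1 := by linarith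
  have hr2 : (0 : ℝ) ≤ 2 * (m : ℝ) * (2 * m + 1) / (2 * π) ^ 2 - 1 / 2 := by linarith
  have hE4 := exp_neg_pi_sq_div_four_ge
  have hR2 := exp_neg_pi_div_two_ge
  have h4 := two_pi_sq_le
  -- non-negativity of the partial products on the right (for `mul_le_mul` inside `gcongr`)
  have hQ1 : (0 : ℝ) ≤ 1195 * (2 * π) * (2 * (m : ℝ) * (2 * m + 1) / (2 * π) ^ 2 - 1) :=
    mul_nonneg (by positivity) hr1
  have hQ2 : (0 : ℝ) ≤ 1195 * (2 * π) * (2 * (m : ℝ) * (2 * m + 1) / (2 * π) ^ 2 - 1)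
      * (2 * (m : ℝ) * (2 * m + 1) / (2 * π) ^ 2 - 1 / 2) ^ 3 := mul_nonneg hQ1 (pow_nonneg hr2 3)
  have hQ3 : (0 : ℝ) ≤ 1195 * (2 * π) * (2 * (m : ℝ) * (2 * m + 1) / (2 * π) ^ 2 - 1)
      * (2 * (m : ℝ) * (2 * m + 1) / (2 * π) ^ 2 - 1 / 2) ^ 3 * Real.exp (-(π ^ 2 / 4)) :=
    mul_nonneg hQ2 (Real.exp_pos _).le
  gcongr

/-- The last factor: `1 + 31.006/(2m + 3.1416) ≤ 1 + π³/(2m + π)` (`3.141592 < π < 3.1416`). [folklore] -/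
private theorem osipovLastFactor_le (m : ℕ) :
    1 + (31006 / 1000 : ℝ) / (2 * m + 31416 / 10000) ≤ 1 + π ^ 3 / (2 * m + π) := by
  have hπhi : π ≤ (31416 / 10000 : ℝ) := by linarith [Real.pi_lt_d4]
  have hP3 := pi_cube_ge
  have hden : (0 : ℝ) < 2 * (m : ℝ) + π := by positivity
  gcongr

/-- **Rational lower envelope.**  For `m ≥ 6`, `L(m)` is at least
`1195·6.28318·(x₁−1)(x₁−½)³·0.0847·0.2078^m·(1 + 31.006/(2m+3.1416))`, `x₁ = 2m(2m+1)/39.4787`.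
[cite: Osipov2013, Thm. 33; WangLL2010, Lemma 2.2] -/
private theorem osipovLowerRat_le {m : ℕ} (hm : 6 ≤ m) :
    1195 * (2 * (314159 / 100000 : ℝ)) * (2 * (m : ℝ) * (2 * m + 1) / (394787 / 10000) - 1)
        * (2 * (m : ℝ) * (2 * m + 1) / (394787 / 10000) - 1 / 2) ^ 3
        * (847 / 10000) * (2078 / 10000) ^ m * (1 + (31006 / 1000) / (2 * m + 31416 / 10000))
      ≤ 1195 * (2 * π) * (2 * (m : ℝ) * (2 * m + 1) / (2 * π) ^ 2 - 1)
        * (2 * (m : ℝ) * (2 * m + 1) / (2 * π) ^ 2 - 1 / 2) ^ 3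
        * Real.exp (-(π ^ 2 / 4)) * Real.exp (-(π / 2)) ^ m * (1 + π ^ 3 / (2 * m + π)) := by
  have hm' : (6 : ℝ) ≤ m := by exact_mod_cast hm
  have h1 : (0 : ℝ) ≤ 2 * (m : ℝ) * (2 * m + 1) / (394787 / 10000) - 1 := by
    rw [sub_nonneg, le_div_iff₀ (by norm_num)]
    nlinarith
  have h2 : (0 : ℝ) ≤ 2 * (m : ℝ) * (2 * m + 1) / (394787 / 10000) - 1 / 2 := by linarith
  have hL0 : (0 : ℝ) ≤ 1195 * (2 * (314159 / 100000 : ℝ))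
      * (2 * (m : ℝ) * (2 * m + 1) / (394787 / 10000) - 1)
      * (2 * (m : ℝ) * (2 * m + 1) / (394787 / 10000) - 1 / 2) ^ 3
      * (847 / 10000) * (2078 / 10000) ^ m :=
    mul_nonneg (mul_nonneg (mul_nonneg (mul_nonneg (by norm_num) h1) (pow_nonneg h2 3))
      (by norm_num)) (pow_nonneg (by norm_num) m)
  have hF0 : (0 : ℝ) ≤ 1 + (31006 / 1000 : ℝ) / (2 * m + 31416 / 10000) := by positivity
  exact mul_le_mul (osipovLowerRat'_le hm) (osipovLastFactor_le m)
    hF0 (hL0.trans (osipovLowerRat'_le hm))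

/-! ## §3 The three regimes

Each regime compares a LANDED tree bound for `|λ(m)|` with the rational envelope of §2; the numerals are
exact rational arithmetic (`norm_num`), checked in floating point beforehand (margins: regime A `≥ 2.2`,
regime B `≥ 13`, regime C base `≈ 8.9`). -/

/-- **Regime A (`6 ≤ m ≤ 10`)**: the rational envelope exceeds `1` (values `18.9, 14.4, 8.9, 4.7, 2.24`).
[cite: Osipov2013, Thm. 33] -/
private theorem one_lt_osipovLowerRat {m : ℕ} (h6 : 6 ≤ m) (h10 : m ≤ 10) :
    (1 : ℝ) < 1195 * (2 * (314159 / 100000 : ℝ)) * (2 * (m : ℝ) * (2 * m + 1) / (394787 / 10000) - 1)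
        * (2 * (m : ℝ) * (2 * m + 1) / (394787 / 10000) - 1 / 2) ^ 3
        * (847 / 10000) * (2078 / 10000) ^ m * (1 + (31006 / 1000) / (2 * m + 31416 / 10000)) := by
  interval_cases m <;> norm_num

/-- **Regime B (`11 ≤ m ≤ 21`)**: the moment-sum majorant of `|λ(m)|` (`abs_prolateEigen_le_momentSum`,
with `π` replaced by `3.1416`) is below the rational envelope (ratio `≥ 13` at `m = 11`, then growing
by a factor `≈ 4–9` per step). [cite: Osipov2013, Thm. 33; ConnesConsani2021, §4 p. 16 eq. (rapid-decay) (arXiv p0016:L34–L37)] -/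
private theorem momentSumRat_lt_osipovLowerRat {m : ℕ} (h11 : 11 ≤ m) (h21 : m ≤ 21) :
    3 * ((∑ i ∈ range m, (2 * (3.1416 : ℝ)) ^ (2 * i) / ((2 * i).factorial : ℝ)
        * ((2 * (3.1416 : ℝ) ^ 2) ^ (m - i) / (((m - i).factorial : ℝ) * (2 * (m : ℝ) + 2 * i + 1) ^ (m - i))))
        + 2 * (2 * (3.1416 : ℝ)) ^ (2 * m) / ((2 * m).factorial : ℝ))
      < 1195 * (2 * (314159 / 100000 : ℝ)) * (2 * (m : ℝ) * (2 * m + 1) / (394787 / 10000) - 1)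
        * (2 * (m : ℝ) * (2 * m + 1) / (394787 / 10000) - 1 / 2) ^ 3
        * (847 / 10000) * (2078 / 10000) ^ m * (1 + (31006 / 1000) / (2 * m + 31416 / 10000)) := by
  interval_cases m <;> norm_num [Finset.sum_range_succ, Nat.factorial]

/-- **Regime C, base (`m = 22`)**: `4(4·3.1416²)²²/(22!)² <` the rational envelope without its last
factor (ratio `≈ 8.9`). [cite: Osipov2013, Thm. 33; ConnesConsani2021, §4 p. 16 eq. (rapid-decay)] -/
private theorem factBoundRat_lt_osipovLowerRat_22 :
    4 * (4 * (3.1416 : ℝ) ^ 2) ^ 22 / ((22 : ℕ).factorial : ℝ) ^ 2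
      < 1195 * (2 * (314159 / 100000 : ℝ)) * (2 * ((22 : ℕ) : ℝ) * (2 * (22 : ℕ) + 1) / (394787 / 10000) - 1)
        * (2 * ((22 : ℕ) : ℝ) * (2 * (22 : ℕ) + 1) / (394787 / 10000) - 1 / 2) ^ 3
        * (847 / 10000) * (2078 / 10000) ^ (22 : ℕ) := by
  norm_num [Nat.factorial]

/-- **Regime C, ratio**: `4(4π²)^{n+1}/((n+1)!)² = 4(4π²)^n/(n!)² · 4π²/(n+1)²`. [folklore] -/
private theorem factBound_succ (n : ℕ) :
    4 * (4 * π ^ 2) ^ (n + 1) / ((n + 1).factorial : ℝ) ^ 2 =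
      4 * (4 * π ^ 2) ^ n / (n.factorial : ℝ) ^ 2 * (4 * π ^ 2 / ((n : ℝ) + 1) ^ 2) := by
  have hf : (n.factorial : ℝ) ≠ 0 := by positivity
  rw [Nat.factorial_succ]
  push_cast
  field_simp
  ring

/-- **Regime C, geometric domination**: for `k ≥ 0`,
`4(4π²)^{22+k}/((22+k)!)² ≤ 4(4π²)²²/(22!)² · (4π²/529)^k` (each ratio `4π²/(n+1)² ≤ 4π²/23²`).
[folklore] -/
private theorem factBound_le_geom (k : ℕ) :
    4 * (4 * π ^ 2) ^ (22 + k) / ((22 + k).factorial : ℝ) ^ 2 ≤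
      4 * (4 * π ^ 2) ^ 22 / ((22 : ℕ).factorial : ℝ) ^ 2 * (4 * π ^ 2 / 529) ^ k := by
  induction k with
  | zero => simp
  | succ k ih =>
    have hF0 : (0 : ℝ) ≤ 4 * (4 * π ^ 2) ^ 22 / ((22 : ℕ).factorial : ℝ) ^ 2 := by positivity
    have hq0 : (0 : ℝ) ≤ 4 * π ^ 2 / 529 := by positivity
    have hratio : 4 * π ^ 2 / (((22 + k : ℕ) : ℝ) + 1) ^ 2 ≤ 4 * π ^ 2 / 529 := by
      apply div_le_div_of_nonneg_left (by positivity) (by norm_num)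
      have hk : (23 : ℝ) ≤ ((22 + k : ℕ) : ℝ) + 1 := by push_cast; linarith [(Nat.cast_nonneg k : (0:ℝ) ≤ k)]
      nlinarith
    rw [show 22 + (k + 1) = (22 + k) + 1 from rfl, factBound_succ (22 + k), pow_succ]
    calc 4 * (4 * π ^ 2) ^ (22 + k) / (((22 + k).factorial : ℝ)) ^ 2 *
          (4 * π ^ 2 / (((22 + k : ℕ) : ℝ) + 1) ^ 2)
        ≤ (4 * (4 * π ^ 2) ^ 22 / ((22 : ℕ).factorial : ℝ) ^ 2 * (4 * π ^ 2 / 529) ^ k) *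
          (4 * π ^ 2 / 529) :=
          mul_le_mul ih hratio (by positivity) (mul_nonneg hF0 (pow_nonneg hq0 k))
      _ = _ := by ring

/-- **`|λ(m)| < L(m)` for every `m ≥ 6`** — the three regimes assembled (A: `|λ| < 1`, B: moment sums,
C: factorial bound with geometric domination from `m = 22`), against the real envelope `L(m)` of §2.
[cite: Osipov2013, Thm. 33; ConnesConsani2021, §4 p. 16 eq. (rapid-decay) (arXiv p0016:L34–L37); WangLL2010, Lemma 2.2] -/
theorem abs_prolateEigen_lt_osipovLower {m : ℕ} (hm : 6 ≤ m) :
    |prolateEigen m| < 1195 * (2 * π) * (2 * (m : ℝ) * (2 * m + 1) / (2 * π) ^ 2 - 1)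
        * (2 * (m : ℝ) * (2 * m + 1) / (2 * π) ^ 2 - 1 / 2) ^ 3
        * Real.exp (-(π ^ 2 / 4)) * Real.exp (-(π / 2)) ^ m * (1 + π ^ 3 / (2 * m + π)) := by
  rcases le_or_gt m 10 with h10 | h10
  · -- regime A
    calc |prolateEigen m| < 1 := abs_prolateEigen_lt_one m
      _ < _ := one_lt_osipovLowerRat hm h10
      _ ≤ _ := osipovLowerRat_le hm
  rcases le_or_gt m 21 with h21 | h21
  · -- regime B
    calc |prolateEigen m| ≤ _ := abs_prolateEigen_le_momentSum hm
      _ ≤ _ := momentSum_mono Real.pi_pos.le Real.pi_lt_d4.le m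
      _ < _ := momentSumRat_lt_osipovLowerRat (by omega) h21
      _ ≤ _ := osipovLowerRat_le hm
  · -- regime C: `m = 22 + k`
    obtain ⟨k, rfl⟩ : ∃ k, m = 22 + k := ⟨m - 22, by omega⟩
    have hπ := Real.pi_pos
    have hπ4 := Real.pi_lt_d4
    have h22 : (6 : ℕ) ≤ 22 := by norm_num
    -- the factorial bound, pushed to the base `m = 22`
    have hF : |prolateEigen (22 + k)| ≤
        4 * (4 * π ^ 2) ^ 22 / ((22 : ℕ).factorial : ℝ) ^ 2 * (4 * π ^ 2 / 529) ^ k :=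
      (abs_prolateEigen_le_explicit (22 + k)).trans (factBound_le_geom k)
    have hFrat : 4 * (4 * π ^ 2) ^ 22 / ((22 : ℕ).factorial : ℝ) ^ 2 ≤
        4 * (4 * (3.1416 : ℝ) ^ 2) ^ 22 / ((22 : ℕ).factorial : ℝ) ^ 2 := by
      gcongr
    -- the geometric ratio `4π²/529 ≤ 0.2078 ≤ e^{−π/2}`
    have hq : 4 * π ^ 2 / 529 ≤ (2078 / 10000 : ℝ) := by
      rw [div_le_iff₀ (by norm_num)]
      nlinarith
    have hqR : (4 * π ^ 2 / 529) ^ k ≤ Real.exp (-(π / 2)) ^ k :=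
      pow_le_pow_left₀ (by positivity) (hq.trans exp_neg_pi_div_two_ge) k
    -- the envelope at `22`, then monotonicity `22 ↦ 22 + k` of the polynomial factors
    have hbase := factBoundRat_lt_osipovLowerRat_22
    have henv := osipovLowerRat'_le h22
    have hk0 : (0 : ℝ) ≤ k := Nat.cast_nonneg k
    have hc2 : (0 : ℝ) < (2 * π) ^ 2 := by positivity
    have hx22 : 2 * ((22 : ℕ) : ℝ) * (2 * (22 : ℕ) + 1) / (2 * π) ^ 2 ≤
        2 * ((22 + k : ℕ) : ℝ) * (2 * ((22 + k : ℕ) : ℝ) + 1) / (2 * π) ^ 2 := by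
      apply div_le_div_of_nonneg_right _ hc2.le
      push_cast
      nlinarith
    have hr1 : (0 : ℝ) ≤ 2 * ((22 : ℕ) : ℝ) * (2 * (22 : ℕ) + 1) / (2 * π) ^ 2 - 1 := by
      rw [sub_nonneg, le_div_iff₀ hc2]
      push_cast
      nlinarith
    have hr2 : (0 : ℝ) ≤ 2 * ((22 : ℕ) : ℝ) * (2 * (22 : ℕ) + 1) / (2 * π) ^ 2 - 1 / 2 := by
      linarith
    have hpoly : 1195 * (2 * π) * (2 * ((22 : ℕ) : ℝ) * (2 * (22 : ℕ) + 1) / (2 * π) ^ 2 - 1)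
        * (2 * ((22 : ℕ) : ℝ) * (2 * (22 : ℕ) + 1) / (2 * π) ^ 2 - 1 / 2) ^ 3 ≤
        1195 * (2 * π) * (2 * ((22 + k : ℕ) : ℝ) * (2 * ((22 + k : ℕ) : ℝ) + 1) / (2 * π) ^ 2 - 1)
        * (2 * ((22 + k : ℕ) : ℝ) * (2 * ((22 + k : ℕ) : ℝ) + 1) / (2 * π) ^ 2 - 1 / 2) ^ 3 := by
      have hQ1 : (0 : ℝ) ≤ 1195 * (2 * π) *
          (2 * ((22 + k : ℕ) : ℝ) * (2 * ((22 + k : ℕ) : ℝ) + 1) / (2 * π) ^ 2 - 1) :=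
        mul_nonneg (by positivity) (by linarith)
      gcongr
    have hlast : (1 : ℝ) ≤ 1 + π ^ 3 / (2 * ((22 + k : ℕ) : ℝ) + π) := by
      have : (0 : ℝ) ≤ π ^ 3 / (2 * ((22 + k : ℕ) : ℝ) + π) := by positivity
      linarith
    -- assemble
    have hE : 0 < Real.exp (-(π ^ 2 / 4)) := Real.exp_pos _
    have hR : 0 < Real.exp (-(π / 2)) := Real.exp_pos _
    have hbig0 : (0 : ℝ) ≤ 1195 * (2 * π) *
        (2 * ((22 + k : ℕ) : ℝ) * (2 * ((22 + k : ℕ) : ℝ) + 1) / (2 * π) ^ 2 - 1)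
        * (2 * ((22 + k : ℕ) : ℝ) * (2 * ((22 + k : ℕ) : ℝ) + 1) / (2 * π) ^ 2 - 1 / 2) ^ 3
        * Real.exp (-(π ^ 2 / 4)) * Real.exp (-(π / 2)) ^ (22 + k) := by
      have : (0 : ℝ) ≤ 2 * ((22 + k : ℕ) : ℝ) * (2 * ((22 + k : ℕ) : ℝ) + 1) / (2 * π) ^ 2 - 1 := by
        linarith
      have h' : (0 : ℝ) ≤ 2 * ((22 + k : ℕ) : ℝ) * (2 * ((22 + k : ℕ) : ℝ) + 1) / (2 * π) ^ 2 - 1 / 2 := by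
        linarith
      exact mul_nonneg (mul_nonneg (mul_nonneg (mul_nonneg (by positivity) this) (pow_nonneg h' 3))
        hE.le) (pow_nonneg hR.le _)
    calc |prolateEigen (22 + k)|
        ≤ 4 * (4 * π ^ 2) ^ 22 / ((22 : ℕ).factorial : ℝ) ^ 2 * (4 * π ^ 2 / 529) ^ k := hF
      _ ≤ 4 * (4 * (3.1416 : ℝ) ^ 2) ^ 22 / ((22 : ℕ).factorial : ℝ) ^ 2 * Real.exp (-(π / 2)) ^ k :=
          mul_le_mul hFrat hqR (by positivity) (by positivity)
      _ < 1195 * (2 * π) * (2 * ((22 : ℕ) : ℝ) * (2 * (22 : ℕ) + 1) / (2 * π) ^ 2 - 1)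
          * (2 * ((22 : ℕ) : ℝ) * (2 * (22 : ℕ) + 1) / (2 * π) ^ 2 - 1 / 2) ^ 3
          * Real.exp (-(π ^ 2 / 4)) * Real.exp (-(π / 2)) ^ (22 : ℕ) * Real.exp (-(π / 2)) ^ k := by
          gcongr ?_ * _
          exact hbase.trans_le henv
      _ = (1195 * (2 * π) * (2 * ((22 : ℕ) : ℝ) * (2 * (22 : ℕ) + 1) / (2 * π) ^ 2 - 1)
          * (2 * ((22 : ℕ) : ℝ) * (2 * (22 : ℕ) + 1) / (2 * π) ^ 2 - 1 / 2) ^ 3)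
          * (Real.exp (-(π ^ 2 / 4)) * Real.exp (-(π / 2)) ^ (22 + k)) := by rw [pow_add]; ring
      _ ≤ (1195 * (2 * π) * (2 * ((22 + k : ℕ) : ℝ) * (2 * ((22 + k : ℕ) : ℝ) + 1) / (2 * π) ^ 2 - 1)
          * (2 * ((22 + k : ℕ) : ℝ) * (2 * ((22 + k : ℕ) : ℝ) + 1) / (2 * π) ^ 2 - 1 / 2) ^ 3)
          * (Real.exp (-(π ^ 2 / 4)) * Real.exp (-(π / 2)) ^ (22 + k)) :=
          mul_le_mul_of_nonneg_right hpoly (by positivity)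
      _ = 1195 * (2 * π) * (2 * ((22 + k : ℕ) : ℝ) * (2 * ((22 + k : ℕ) : ℝ) + 1) / (2 * π) ^ 2 - 1)
          * (2 * ((22 + k : ℕ) : ℝ) * (2 * ((22 + k : ℕ) : ℝ) + 1) / (2 * π) ^ 2 - 1 / 2) ^ 3
          * Real.exp (-(π ^ 2 / 4)) * Real.exp (-(π / 2)) ^ (22 + k) * 1 := by ring
      _ ≤ _ := mul_le_mul_of_nonneg_left hlast hbig0

/-! ## §4 The dictionary and the discharge -/

/-- **Osipov 2013, Theorem 33 at `c = 2π` — PROVED** (discharge of the named fact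
`Osipov2013_thm_33` of `ProlateEigenvalueDecay.lean`; net debt −1).  For `IsProlateFunction 1 n f`
with `n` even and `n > 4 + √42` (so `n = 2m`, `m ≥ 6`): `f = prolateFun m`, the Fourier eigen-relation
at `ω = 0` gives `μ = (∫f)/f(0) = λ(m)`, Wang's window localises `χ`, and `|λ(m)| < L(m) ≤` Osipov's
right-hand side (§2–§3).  NOT Osipov's proof: a comparison, at the typed band-limit only, with the
tree's elementary explicit bounds. [cite: Osipov2013, Thm. 33 (arXiv:1206.4541 chunk p0018:L158–L175); WangLL2010, Lemma 2.2; ConnesConsani2021, §4 p. 16 eqs. (prolateeq), (cosalphan), (rapid-decay)] -/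
theorem Osipov2013_thm_33_holds : Osipov2013_thm_33 := by
  intro N f χ μ hf hχ hμ heven hN
  obtain ⟨m, hNm⟩ := heven
  obtain rfl : N = 2 * m := by omega
  -- `m ≥ 6` from `2m > 4 + √42 > 10`
  have hm : 6 ≤ m := by
    have hs : (6 : ℝ) < Real.sqrt 42 := by
      rw [show (6 : ℝ) = Real.sqrt (6 ^ 2) by rw [Real.sqrt_sq (by norm_num)]]
      exact Real.sqrt_lt_sqrt (by norm_num) (by norm_num)
    have h10 : (10 : ℝ) < ((2 * m : ℕ) : ℝ) := by linarith
    have h10' : 10 < 2 * m := by exact_mod_cast h10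
    omega
  -- dictionary: `f = prolateFun m`, `μ = λ(m)`
  have hfun : f = prolateFun m := eq_prolateFun_of_isProlateFunction hf
  have hμeq : μ = prolateEigen m := by
    have h0 := hμ 0 (by norm_num)
    simp only [Complex.ofReal_zero, mul_zero, Complex.exp_zero, mul_one] at h0
    rw [intervalIntegral.integral_ofReal] at h0
    have hre : (∫ x in (-1 : ℝ)..1, f x) = μ * f 0 := by exact_mod_cast h0
    have hf0 : f 0 ≠ 0 := hf.pos_zero.ne'
    rw [prolateEigen_eq_intervalIntegral, ← hfun, hre, mul_div_cancel_right₀ _ hf0]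
  -- Wang's window
  have hW := Wang2010_lemma_2_2_holds 1 (2 * m) f χ hf hχ
  push_cast at hW
  simp only [one_pow, mul_one] at hW
  have hlo : 2 * (m : ℝ) * (2 * m + 1) < χ := by nlinarith [hW.1]
  have hhi : χ < 2 * (m : ℝ) * (2 * m + 1) + (2 * π) ^ 2 := by nlinarith [hW.2]
  rw [hμeq]
  exact (abs_prolateEigen_lt_osipovLower hm).trans_le (osipovBound_lower hm hlo hhi)

end Literature.NumberTheory.LFunctions

end
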